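import Literature.Analysis.FluidPDE.ForcedSerrinEnstrophyBound
import Literature.Analysis.FluidPDE.WholeSpaceIBP
import Literature.Analysis.FluidPDE.CheskidovShvydkoyRegular
import Literature.Analysis.FluidPDE.LerayLocalRegularH1Proofs
import Literature.Analysis.FluidPDE.SpaceTimeRescaling
import Literature.Analysis.FunctionSpaces.SobolevDomainNormProofs
import Summits.NavierStokesRegularity.NavierStokesRegularity.Theorems.TaoForcedUniqueness.Negative.CountableJunkForce
import Literature.Analysis.FluidPDE.DivCurlAnnihilator
import Literature.Analysis.FluidPDE.CKNInterpolationEstimate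

/-!
# KJ-6 (1/9): the label function, homogeneity of the dissipation, the PROFILE, the concentrating dilation and the witness `u t = t • U_{λ(t)}`

Cell `ns-blowup`, seat `ns-blowup-refuter` (g10 blueprint, g11 kernel), KILLSHEET §XXIV rows KJ-6/KJ-7,
part 1/9 of the kernel certificate `¬ Literature.Analysis.FluidPDE.Sohr2001_serrinClass_enstrophyBound(_global)`
(final file `SohrSerrinEnstrophyCountableJunk.lean` in this directory, which carries the full account and the
classification). LABEL: refuter construction (explicit data + proved lemmas; no named facts, no `sorry`).
WHAT THIS IS NOT: not Navier–Stokes evidence and not a statement about Sohr's printed theorem — a hygiene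
refutation of two facts AS TYPED (slice-wise force class `MemLqLp 2 2`, one outer Bochner integral in the
weak form); nothing here mentions the summit.

Content: `exists_label` (a label `ℓ` of a saturated countable partition, from `SaturatedPartition.lean`);
`eWeakGradL2Sq (c • v) = c² · eWeakGradL2Sq v`; the structure `Profile` (smooth, divergence free, in every
`L^p`, `2 ≤ p < ∞`, `0 < ‖∇U‖₂² < ∞`, NOT compactly supported — `far` —, quadratic decay) and its inhabitant
`SwirlWitness.profile` = refuter4's `swirl` (`CountableJunkProfile.lean`); `lamSq T t = 1 + |t − T/2|^{-1/4}`,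
`lam = √lamSq`, the `L²`-unitary dilate `dilate c U = c^{1/2} • nsRescaleData c U`, `c₁ = ‖∇U‖₂²/‖U‖₂²`,
`kappa ν T t = 1 + ν t λ(t)² c₁`, the witness `uW T t = t • dilate (lam T t) U` (`:= 0` at `t = T/2`) and its
enstrophy `‖∇u(t)‖₂² = t² λ(t)² ‖∇U‖₂²` (`t ≠ T/2`).
-/

noncomputable section

namespace Summit.NavierStokesRegularity.ForcedUniquenessHygiene.KJ6

open MeasureTheory Set Function Filter Topology Metric
open scoped ENNReal NNReal RealInnerProductSpace ContDiff Laplacian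
open Literature.Analysis.FluidPDE Literature.Analysis.FunctionSpaces

/-- Euclidean `ℝ³` (file-local notation, as in the `Literature.Analysis.FluidPDE` files). -/
local notation "ℝ³" => EuclideanSpace ℝ (Fin 3)

/-! ## §1 Saturated countable partition of the time axis and the labelling lemma

LANDED (refuter g10, p421097): `…/Theorems/TaoForcedUniqueness/Negative/SaturatedPartition.lean` —
`exists_saturated_partition`, `ae_eq_of_aestronglyMeasurable_label` (label hypothesis
`hℓ : ∀ m, ∀ t ∈ P m, ℓ t = m`), `not_aestronglyMeasurable_label(_of_ne)`, `integral_label_eq_zero`;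
parent namespace, used unqualified. -/

/-- A label function of a pairwise disjoint cover, with both directions of the labelling. -/
theorem exists_label {P : ℕ → Set ℝ} (hdisj : Pairwise (Function.onFun Disjoint P))
    (hcov : (⋃ m, P m) = univ) :
    ∃ ℓ : ℝ → ℕ, (∀ t, t ∈ P (ℓ t)) ∧ ∀ m, ∀ t ∈ P m, ℓ t = m := by
  have h : ∀ t : ℝ, ∃ m, t ∈ P m := fun t => by
    have : t ∈ ⋃ m, P m := by rw [hcov]; trivial
    simpa using this
  choose ℓ hℓ using h
  refine ⟨ℓ, hℓ, fun m t ht => ?_⟩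
  by_contra hne
  exact Set.disjoint_left.mp (hdisj hne) (hℓ t) ht

/-! ## §2 Homogeneity of the weak dissipation -/

/-- `eWeakGradL2Sq (c • v) ≤ c² · eWeakGradL2Sq v`: `c • G` is a weak gradient of `c • v` whenever `G`
is one of `v` (`HasWeakFDerivOn.const_smul`), and `|c G|² = c² |G|²` (`frobeniusNormSq_smul`). -/
theorem eWeakGradL2Sq_const_smul_le (c : ℝ) (v : ℝ³ → ℝ³) :
    eWeakGradL2Sq (c • v) ≤ ENNReal.ofReal (c ^ 2) * eWeakGradL2Sq v := by
  rcases eq_or_ne c 0 with rfl | hc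
  · -- `0 • v = 0` has the weak gradient `0`
    have h := hasWeakGradient_fderiv_of_contDiff
      (contDiff_const : ContDiff ℝ 1 (fun _ : ℝ³ => (0 : ℝ³)))
    have h0 : (fderiv ℝ (fun _ : ℝ³ => (0 : ℝ³))) = fun _ => 0 := by
      ext1 x; exact fderiv_const_apply 0
    have e : ((0 : ℝ) • v) = fun _ : ℝ³ => (0 : ℝ³) := by funext x; simp
    rw [e]
    refine (eWeakGradL2Sq_le_of_hasWeakGradient h).trans ?_
    simp [h0, frobeniusNormSq_zero]
  have hc2 : ENNReal.ofReal (c ^ 2) ≠ 0 := (ENNReal.ofReal_pos.2 (by positivity)).ne'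
  rw [eWeakGradL2Sq, eWeakGradL2Sq, ENNReal.mul_iInf_of_ne hc2 ENNReal.ofReal_ne_top]
  refine le_iInf fun G => ?_
  rw [ENNReal.mul_iInf_of_ne hc2 ENNReal.ofReal_ne_top]
  refine le_iInf fun hG => ?_
  refine (iInf₂_le (c • G) (HasWeakFDerivOn.const_smul hG c)).trans (le_of_eq ?_)
  rw [← lintegral_const_mul' _ _ ENNReal.ofReal_ne_top]
  refine lintegral_congr fun x => ?_
  rw [Pi.smul_apply, frobeniusNormSq_smul, ENNReal.ofReal_mul (sq_nonneg c)]

/-- **Homogeneity**: `eWeakGradL2Sq (c • v) = c² · eWeakGradL2Sq v` for `c ≠ 0`. -/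
theorem eWeakGradL2Sq_const_smul {c : ℝ} (hc : c ≠ 0) (v : ℝ³ → ℝ³) :
    eWeakGradL2Sq (c • v) = ENNReal.ofReal (c ^ 2) * eWeakGradL2Sq v := by
  refine le_antisymm (eWeakGradL2Sq_const_smul_le c v) ?_
  have h := eWeakGradL2Sq_const_smul_le c⁻¹ (c • v)
  rw [smul_smul, inv_mul_cancel₀ hc, one_smul] at h
  calc ENNReal.ofReal (c ^ 2) * eWeakGradL2Sq v
      ≤ ENNReal.ofReal (c ^ 2) * (ENNReal.ofReal (c⁻¹ ^ 2) * eWeakGradL2Sq (c • v)) :=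
        by gcongr
    _ = eWeakGradL2Sq (c • v) := by
        rw [← mul_assoc, ← ENNReal.ofReal_mul (sq_nonneg c), ← mul_pow, mul_inv_cancel₀ hc,
          one_pow, ENNReal.ofReal_one, one_mul]

/-! ## §3 The profile, the concentrating dilation and the witness -/

/-- A feeding PROFILE: a smooth divergence-free field in every `L^p`, `2 ≤ p < ∞`, with non-trivial finite
dissipation and UNBOUNDED support (`far`). DESIGN NOTE (lit g9 K-REMARK, cell STATUS l.2342 (2)): with a
compactly supported profile the test fields `ψ t = θ₀(t) • U_{λ(t)}` (`θ₀ ∈ C_c^∞((0,T) ∖ {T/2})`) are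
admissible and HONEST, so the weak form is NOT void and its verification needs the one-mode Galerkin
identity integrated across the blow-up instant (≈ 300–400 lines); with `far`, totality plus the compact
support of every test slice force `ψ ≡ 0` on `(0,T)` — K54 (4) verbatim, no Galerkin calculus. -/
structure Profile where
  U : ℝ³ → ℝ³
  smooth : ContDiff ℝ (⊤ : ℕ∞) U
  divFree : IsWeaklyDivFree U
  memLp : ∀ p : ℝ≥0∞, 2 ≤ p → p ≠ ⊤ → MemLp U p volume
  grad_pos : 0 < eWeakGradL2Sq U
  grad_lt_top : eWeakGradL2Sq U < ⊤
  far : ∀ K : Set ℝ³, IsCompact K → ∃ x ∉ K, U x ≠ 0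
  decay : ∃ C : ℝ, ∀ x, ‖U x‖ ≤ C * (1 + ‖x‖ ^ 2)⁻¹

/-- A linear map with vanishing Frobenius norm is zero. -/
theorem eq_zero_of_frobeniusNormSq_eq_zero {T : ℝ³ →L[ℝ] ℝ³} (h : frobeniusNormSq T = 0) : T = 0 := by
  set b := stdOrthonormalBasis ℝ ℝ³
  have h0 : ∀ i, T (b i) = 0 := by
    intro i
    have := (Finset.sum_eq_zero_iff_of_nonneg (fun j _ => sq_nonneg ‖T (b j)‖)).1 h i (Finset.mem_univ _)
    simpa using this
  ext v : 1
  rw [← b.sum_repr' v, map_sum]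
  simp [map_smul, h0]

/-! ### The concrete profile: refuter4's `swirl` `U(x) = (1+|x|²)⁻² (−x₁, x₀, 0)` (K54 part 1, tree file
`…/Negative/CountableJunkProfile.lean`): smooth, divergence free, in `L^p` for `2 ≤ p < ∞`,
`∫ |∇U|²_F < ∞`, not compactly supported. Added here: the dissipation is POSITIVE (a field with
identically vanishing derivative is constant, and `swirl e₀ ≠ 0 = swirl 0`). -/
namespace SwirlWitness

open Summit.NavierStokesRegularity.ForcedUniquenessCountableJunk hiding frobeniusNormSq_smul

/-- refuter4's profile, by its full name (the opened `Literature.Analysis.FluidPDE` also has a `swirl`). -/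
local notation "𝐔" => Summit.NavierStokesRegularity.ForcedUniquenessCountableJunk.swirl

/-- The dissipation density of `swirl`. -/
def F (x : ℝ³) : ℝ := frobeniusNormSq (fderiv ℝ 𝐔 x)

/-- The dissipation density `F = |∇swirl|²_F` is continuous. -/
theorem continuous_F : Continuous F :=
  continuous_frobeniusNormSq'.comp (swirl_contDiff.continuous_fderiv (by simp))

/-- `F ≥ 0`. -/
theorem F_nonneg : 0 ≤ F := fun _ => frobeniusNormSq_nonneg _

/-- `F` is integrable (the `swirl` profile has finite dissipation). -/
theorem integrable_F : Integrable F := by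
  refine ⟨continuous_F.aestronglyMeasurable, ?_⟩
  have h : ∫⁻ x, ‖F x‖ₑ = ∫⁻ x, ENNReal.ofReal (F x) :=
    lintegral_congr fun x => by rw [Real.enorm_eq_ofReal (F_nonneg x)]
  rw [HasFiniteIntegral, h]
  exact lintegral_frob_fderiv_swirl_lt_top

/-- `‖∇swirl‖₂² = ∫ F` (weak gradient = classical gradient of the `C¹` profile). -/
theorem eWeakGradL2Sq_swirl : eWeakGradL2Sq 𝐔 = ENNReal.ofReal (∫ x, F x) := by
  rw [eWeakGradL2Sq_eq_of_hasWeakGradient (hasWeakGradient_fderiv_of_contDiff swirl_contDiff_one)]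
  rw [ofReal_integral_eq_lintegral_ofReal integrable_F (Eventually.of_forall F_nonneg)]
  rfl

/-- `swirl 0 = 0`. -/
theorem swirl_zero : 𝐔 0 = 0 := by simp [Summit.NavierStokesRegularity.ForcedUniquenessCountableJunk.swirl]

/-- `∫ F > 0`: `F` is continuous, nonnegative and not identically zero (the profile is not constant). -/
theorem integral_F_pos : 0 < ∫ x, F x := by
  rw [integral_pos_iff_support_of_nonneg F_nonneg integrable_F]
  refine continuous_F.isOpen_support.measure_pos volume ?_
  by_contra hempty
  rw [Set.not_nonempty_iff_eq_empty, Function.support_eq_empty_iff] at hempty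
  have hD : ∀ x, fderiv ℝ 𝐔 x = 0 := fun x =>
    eq_zero_of_frobeniusNormSq_eq_zero (congr_fun hempty x)
  have hconst := is_const_of_fderiv_eq_zero (swirl_contDiff_one.differentiable one_ne_zero) hD (e 0) 0
  exact swirl_e0_ne_zero (hconst.trans swirl_zero)

/-- The dissipation of `swirl` is positive. -/
theorem eWeakGradL2Sq_swirl_pos : 0 < eWeakGradL2Sq 𝐔 := by
  rw [eWeakGradL2Sq_swirl]; exact ENNReal.ofReal_pos.2 integral_F_pos

/-- The dissipation of `swirl` is finite. -/
theorem eWeakGradL2Sq_swirl_lt_top : eWeakGradL2Sq 𝐔 < ⊤ := by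
  rw [eWeakGradL2Sq_swirl]; exact ENNReal.ofReal_lt_top

/-- `swirl` is a profile. -/
def profile : Profile where
  U := 𝐔
  smooth := swirl_contDiff
  divFree := swirl_isWeaklyDivFree
  memLp := fun _ hp hp' => memLp_swirl hp hp'
  grad_pos := eWeakGradL2Sq_swirl_pos
  grad_lt_top := eWeakGradL2Sq_swirl_lt_top
  far := fun _ hK => exists_swirl_ne_zero_not_mem hK
  decay := ⟨2, norm_swirl_le⟩

end SwirlWitness

/-- A profile exists (`SwirlWitness.profile`). -/
theorem exists_profile : Nonempty Profile := ⟨SwirlWitness.profile⟩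

variable (Pr : Profile)

/-- `λ(t) = (1 + |t − T/2|^{-1/4})^{1/2} ≥ 1`, `→ ∞` as `t → T/2` (real junk value `0 ^ (-1/4) = 0` AT
`t = T/2` is harmless: that slice of `u` is set to `0` by hand). -/
def lamSq (T t : ℝ) : ℝ := 1 + |t - T / 2| ^ (-(1 / 4 : ℝ))

/-- `1 ≤ λ(t)²`. -/
theorem one_le_lamSq (T t : ℝ) : 1 ≤ lamSq T t := by
  unfold lamSq
  have : 0 ≤ |t - T / 2| ^ (-(1 / 4 : ℝ)) := Real.rpow_nonneg (abs_nonneg _) _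
  linarith

/-- `0 < λ(t)²`. -/
theorem lamSq_pos (T t : ℝ) : 0 < lamSq T t := lt_of_lt_of_le one_pos (one_le_lamSq T t)

/-- `λ(t)`. -/
def lam (T t : ℝ) : ℝ := Real.sqrt (lamSq T t)

/-- `0 < λ(t)`. -/
theorem lam_pos (T t : ℝ) : 0 < lam T t := Real.sqrt_pos.2 (lamSq_pos T t)

/-- `λ(t)² = lamSq T t`. -/
theorem lam_sq (T t : ℝ) : lam T t ^ 2 = lamSq T t := Real.sq_sqrt (lamSq_pos T t).le

/-- The `L²`-unitary dilate `U_λ = λ^{1/2} • (λ U(λ ·)) = λ^{3/2} U(λ ·)`. -/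
def dilate (c : ℝ) (U : ℝ³ → ℝ³) : ℝ³ → ℝ³ := Real.sqrt c • nsRescaleData c U

/-- `‖∇U_λ‖₂² = λ² ‖∇U‖₂²`. -/
theorem eWeakGradL2Sq_dilate {c : ℝ} (hc : 0 < c) (U : ℝ³ → ℝ³) :
    eWeakGradL2Sq (dilate c U) = ENNReal.ofReal (c ^ 2) * eWeakGradL2Sq U := by
  rw [dilate, eWeakGradL2Sq_const_smul (Real.sqrt_pos.2 hc).ne', Real.sq_sqrt hc.le,
    eWeakGradL2Sq_nsRescaleData_three hc, ← mul_assoc, ← ENNReal.ofReal_mul hc.le, sq]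

/-- `c₁ = ‖∇U‖₂² / ‖U‖₂²`-type constant (exact value irrelevant for the skeleton). -/
def c₁ : ℝ := (eWeakGradL2Sq Pr.U).toReal / ∫ x, ‖Pr.U x‖ ^ 2

/-- Honest feeding amplitude `κ(t) = 1 + ν t λ(t)² c₁` (one-mode energy identity
`d/dt(½t²‖U‖²) + ν t² λ² ‖∇U‖² = κ t ‖U‖²`, i.e. energy EQUALITY off `t = T/2`). -/
def kappa (ν T t : ℝ) : ℝ := 1 + ν * t * lamSq T t * c₁ Pr

/-- The velocity witness `u t = t • U_{λ(t)}` for `t ≠ T/2`, `u (T/2) = 0`. -/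
def uW (T : ℝ) (t : ℝ) : ℝ³ → ℝ³ := if t = T / 2 then 0 else t • dilate (lam T t) Pr.U

/-- **Enstrophy of the witness**: `‖∇u(t)‖₂² = t² λ(t)² ‖∇U‖₂²` for `t ≠ T/2`, `t ≠ 0`. -/
theorem eWeakGradL2Sq_uW {T t : ℝ} (ht : t ≠ T / 2) (ht0 : t ≠ 0) :
    eWeakGradL2Sq (uW Pr T t) = ENNReal.ofReal (t ^ 2 * lamSq T t) * eWeakGradL2Sq Pr.U := by
  rw [uW, if_neg ht, eWeakGradL2Sq_const_smul ht0, eWeakGradL2Sq_dilate (lam_pos T t), lam_sq,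
    ← mul_assoc, ← ENNReal.ofReal_mul (sq_nonneg t)]

end Summit.NavierStokesRegularity.ForcedUniquenessHygiene.KJ6
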